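import Summits.AtomisticToContinuum.FouriersLaw.Theses.ContactStieltjesMeasure

/-!
# `ContactMeasureLimit` (stmt-AtomisticToContinuum-15250): the response clause is load-bearing

Refuter vetting lemma (crux-attack, route `ContactStieltjesMeasure`). The crux `ContactMeasureLimit`
quantifies over families `Φ : ℕ → ℝ → ℝ` constrained by (a) a STRUCTURAL part — each `Φ N` (`N ≥ 2`)
is monotone, vanishes on `(-∞,0]` and is bounded above — and (b) the RESPONSE clause tying
`(N-1)·γ·∫₀^∞ Φ_N(t)·2t/(γ²+t²)² dt` to the linear response of the pinned chain at every friction `γ`.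
`contactMeasureLimit_false_without_response` shows that with (b) dropped (the statement is written
inline: the crux's `Φ`-hypothesis minus its last conjunct, same conclusion) the conclusion
(`N·Φ_N(t) → M(t)` at the continuity points `t > 0` of a monotone `M`) is FALSE: the indicator family
`Φ_N = 1_{(0,∞)}` is admissible for (a) and `N·Φ_N(t) = N → ∞`. Hence any proof of the crux must use
the response clause (b), i.e. the Stieltjes representation `StieltjesRepresentation` (K2) of the
finite-`N` response; conversely, if no representing family exists the crux holds vacuously.
-/

namespace Summit.AtomisticToContinuum.FouriersLaw.Theorems.ContactMeasureLimit.Negative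

open Filter MeasureTheory Set

/-- A monotone function `ℝ → ℝ` has a continuity point in `(0, ∞)` (its discontinuity set is countable,
hence Lebesgue-null, while `(0,∞)` has infinite measure). [folklore] -/
theorem exists_pos_continuousAt_of_monotone {M : ℝ → ℝ} (hM : Monotone M) :
    ∃ t : ℝ, 0 < t ∧ ContinuousAt M t := by
  by_contra h
  push Not at h
  have hsub : Set.Ioi (0 : ℝ) ⊆ {x | ¬ContinuousAt M x} := fun t ht => h t ht
  have h0 : volume {x | ¬ContinuousAt M x} = 0 := hM.countable_not_continuousAt.measure_zero _
  have h1 : volume (Set.Ioi (0 : ℝ)) = 0 := measure_mono_null hsub h0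
  simp [Real.volume_Ioi] at h1

/-- **The response clause of `ContactMeasureLimit` is load-bearing**: the structural constraints alone
(monotone, vanishing on `(-∞,0]`, bounded) do not give a scaled limit — witness `Φ_N = 1_{(0,∞)}`, for
which `N·Φ_N(t) = N` diverges at every `t > 0`. [folklore] -/
theorem contactMeasureLimit_false_without_response :
    ¬ (∀ Φ : ℕ → ℝ → ℝ,
        (∀ N : ℕ, 2 ≤ N →
            Monotone (Φ N) ∧ (∀ s : ℝ, s ≤ 0 → Φ N s = 0) ∧ (∃ m : ℝ, ∀ s : ℝ, Φ N s ≤ m)) →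
          ∃ M : ℝ → ℝ, Monotone M ∧ ∀ t : ℝ, 0 < t → ContinuousAt M t →
            Filter.Tendsto (fun N : ℕ => (N : ℝ) * Φ N t) Filter.atTop (nhds (M t))) := by
  intro h
  let Φ : ℕ → ℝ → ℝ := fun _ t => if 0 < t then 1 else 0
  have hΦ : ∀ N : ℕ, 2 ≤ N →
      Monotone (Φ N) ∧ (∀ s : ℝ, s ≤ 0 → Φ N s = 0) ∧ (∃ m : ℝ, ∀ s : ℝ, Φ N s ≤ m) := by
    intro N _
    refine ⟨?_, ?_, ⟨1, ?_⟩⟩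
    · intro a b hab
      simp only [Φ]
      split_ifs with ha hb
      · exact le_rfl
      · exact absurd (lt_of_lt_of_le ha hab) hb
      · exact zero_le_one
      · exact le_rfl
    · intro s hs
      simp only [Φ, if_neg (not_lt.mpr hs)]
    · intro s
      simp only [Φ]
      split_ifs
      · exact le_rfl
      · exact zero_le_one
  obtain ⟨M, hMmono, hM⟩ := h Φ hΦ
  obtain ⟨t, ht, hcont⟩ := exists_pos_continuousAt_of_monotone hMmono
  have hlim := hM t ht hcont
  have hfun : (fun N : ℕ => (N : ℝ) * Φ N t) = fun N : ℕ => (N : ℝ) := by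
    funext N
    simp only [Φ, if_pos ht, mul_one]
  rw [hfun] at hlim
  exact not_tendsto_nhds_of_tendsto_atTop tendsto_natCast_atTop_atTop (M t) hlim

end Summit.AtomisticToContinuum.FouriersLaw.Theorems.ContactMeasureLimit.Negative
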